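/-
Copyright (c) 2026 the pub-hodgecm-mathlib formalisation cell (harness21).  Prover seat hodgecm-mathlib-F0P2-p06 (g10), 2026-09-01.  Road «S3-tree» (architect A-p16 (g30) A-88 (8)),
brick T3′ «depth-zero κ-transfer», population (P-2) TYPE (2), row (R0²): organ FILE γ₅ «INTEGRALITY OF THE SHIFTED PAIR» — the binder `hint′` of the ★ type-(2) value theorems for
the Cayley∕Möbius shift `γ_H′` of a deep type-(2) `γ_H`: the characteristic polynomial of `ι(γ_H′)_w` has coefficients in `𝒪_w`.
-/
import Literature.NumberTheory.Rogawski1990.TypeTwoCayleyShiftOrderCM     -- ★ FILE γ₄ (this seat): `mem_integer_iff_valued_le_one`; brings ★ γ₃, γ₂, γ₁, α, β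
import HarnessLib

/-!
# The shifted type-(2) pair is integral at `w`: `charpoly(ι(γ_H′)_w) ∈ 𝒪_w[X]`

Topic `NumberTheory/Rogawski1990`; namespace `Literature.NumberTheory.Rogawski1990`.  THEOREMS ONLY (no definition, no instance, no notation, no named fact, no `sorry`); kernel lane
`--supports stmt-HodgeConjecture-24833`.  Cell `pub/hodgecm-mathlib`, crux H413; road «S3-tree», brick T3′, row (R0²) of the ★ type-(2) socket p846003 (hand-off
`F0/P2/F0P2-p06/g10/HANDOFF-P2-RowZero.F0P2p06g10.md` (γ₄-a)).  HONEST LABEL: HC_CM is proved only modulo the cell's 2 remaining named inputs (hLiu418, h413) until rung 0 closes; this file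
is an ASSEMBLY over ★ material and asserts nothing printed.

THE MATHEMATICS.  `ι(γ_H′)_w = reindex endoPerm (g′_w ⊕ u′_w)` with `g′_w = φ_{c_w}(g_w) = N₊(X₂)N₋(X₂)⁻¹` entrywise integral (★ γ₁ `forall_valued_moebius_le_one`: `X₂ = c_w⁻¹(g_w − 1)` integral,
`det N₋(X₂)` a unit by ★ γ₃) and `|u′_w| = 1` (★ γ₁ `valued_moebius_one_eq_one`); an entrywise-integral matrix has characteristic polynomial over `𝒪_w` (★ α `charpoly_coeff_mem_of_forall_mem`).

## References
* [Kottwitz1986] R. E. Kottwitz, *Base change for unit elements of Hecke algebras*, Compositio Math. 60 (1986), §3.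
* [Rogawski1990] J. D. Rogawski, *Automorphic Representations of Unitary Groups in Three Variables* (1990), §4.9 Prop. 4.9.1 (b) p. 55.
-/

set_option autoImplicit false

noncomputable section

open NumberField IsDedekindDomain Matrix Polynomial
open scoped MatrixGroups WithZero ValuativeRel

namespace Literature.NumberTheory.Rogawski1990

open Literature.NumberTheory.Automorphic Literature.NumberTheory.Automorphic.UnitaryGroup Literature.NumberTheory.Automorphic.MoebiusShift
open Literature.NumberTheory.GaloisRepresentations Literature.NumberTheory.NumberFields

variable (L : Type) [Field L] [NumberField L] [IsCMField L] (v : HeightOneSpectrum (𝓞 ↥(maximalRealSubfield L)))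
  (w : PlacesOver L v) (hw : IsCMField.complexConj L • w.1 = w.1)

include hw in
set_option maxHeartbeats 1600000 in
-- the carriers' types are large
/-- **`hint′`**: for a deep type-(2) `γ_H` (as in ★ γ₃ `isUnit_shift_denominators_of_typeTwo`) and `γ_H′` with `g′ = φ_c(g)`, `u′ = φ_c(u)`: every coefficient of `charpoly(ι(γ_H′)_w)` lies in `𝒪_w`.
[cite: Kottwitz1986, §3] [cite: Rogawski1990, §4.9 Prop. 4.9.1 (b) p. 55] -/
theorem charpoly_coeff_endoEmbLocal_mem_of_shifted
    (γH γH' : (cmDatum L 2 (Matrix.of fun i j : Fin 2 => if i.val + j.val + 1 = 2 then (1 : L) else 0)).Local v ×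
      (cmDatum L 1 (Matrix.of fun i j : Fin 1 => if i.val + j.val + 1 = 1 then (1 : L) else 0)).Local v)
    {c : LocalRing L v} (hσc : conjLocal L (IsCMField.complexConj L) v c = c) (hc : Valued.v (c w) = WithZero.exp (-1 : ℤ))
    (h2 : Valued.v (2 : w.1.adicCompletion L) = 1)
    (h1 : ((γH'.1.val : GL (Fin 2) (LocalRing L v)).val : Matrix (Fin 2) (Fin 2) (LocalRing L v)) =
      ((c + 1) • ((γH.1.val : GL (Fin 2) (LocalRing L v)).val : Matrix (Fin 2) (Fin 2) (LocalRing L v)) + (c - 1) • 1) *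
        ((c - 1) • ((γH.1.val : GL (Fin 2) (LocalRing L v)).val : Matrix (Fin 2) (Fin 2) (LocalRing L v)) + (c + 1) • 1)⁻¹)
    (hu' : finGammaTwo L v γH' = ((c + 1) * finGammaTwo L v γH + (c - 1)) * Ring.inverse ((c - 1) * finGammaTwo L v γH + (c + 1)))
    (hg1 : ∀ i j, Valued.v ((((γH.1.val : GL (Fin 2) (LocalRing L v)).val.map (Pi.evalRingHom (fun w' : PlacesOver L v => w'.1.adicCompletion L) w)) - 1) i j) ≤ Valued.v (c w))
    (hu1 : Valued.v (finGammaTwo L v γH w - 1) ≤ Valued.v (c w))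
    {N : ℕ} (hN1 : 1 ≤ N)
    (hN : Valued.v (((γH.1.val : GL (Fin 2) (LocalRing L v)).val.map
        (Pi.evalRingHom (fun w' : PlacesOver L v => w'.1.adicCompletion L) w)).trace ^ 2 -
      4 * ((γH.1.val : GL (Fin 2) (LocalRing L v)).val.map
        (Pi.evalRingHom (fun w' : PlacesOver L v => w'.1.adicCompletion L) w)).det) = WithZero.exp (-((2 * N + 1 : ℕ) : ℤ))) :
    ∀ i : ℕ, ((((endoEmbLocal L v γH').val : GL (Fin 3) (LocalRing L v)).val.map
        (Pi.evalRingHom (fun w' : PlacesOver L v => w'.1.adicCompletion L) w)).charpoly.coeff i) ∈ 𝒪[w.1.adicCompletion L] := by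
  have hv : Subsingleton (PlacesOver L v) := PlacesOver.subsingleton_of_smul_eq (IsCMField.complexConj L) (IsCMField.complexConj_ne_one L) w hw
  obtain ⟨hw2m, -, hw1m, hw1p, hU2m, -, hU1m, -, -, -, -⟩ := isUnit_shift_denominators_of_typeTwo L v w hw γH hσc hc h2 hg1 hu1 hN1 hN
  set evw : LocalRing L v →+* w.1.adicCompletion L := Pi.evalRingHom (fun w' : PlacesOver L v => w'.1.adicCompletion L) w with hevw
  set O : Subring (w.1.adicCompletion L) := 𝒪[w.1.adicCompletion L] with hOdef
  have hO : ∀ {z : w.1.adicCompletion L}, z ∈ O ↔ Valued.v z ≤ 1 := fun {z} => mem_integer_iff_valued_le_one L v w z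
  set gw : Matrix (Fin 2) (Fin 2) (w.1.adicCompletion L) := ((γH.1.val : GL (Fin 2) (LocalRing L v)).val.map evw) with hgw
  set uw : w.1.adicCompletion L := finGammaTwo L v γH w with huw
  set cw : w.1.adicCompletion L := c w with hcw
  obtain ⟨hc0, hc1, hcm, hcp, -, -⟩ := shift_parameter_facts hc
  -- `g′_w = N₊N₋⁻¹` is integral
  set X₂ : Matrix (Fin 2) (Fin 2) (w.1.adicCompletion L) := cw⁻¹ • (gw - 1) with hX₂
  have hgX : gw = 1 + cw • X₂ := eq_one_add_smul_inv_smul_sub_one hc0 gw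
  have hX₂i : ∀ i j, Valued.v (X₂ i j) ≤ 1 := forall_valued_inv_smul_sub_one_le_one hc0 hg1
  have hdet2w : ∀ a b : LocalRing L v, ((a • ((γH.1.val : GL (Fin 2) (LocalRing L v)).val : Matrix (Fin 2) (Fin 2) (LocalRing L v)) + b • (1 : Matrix (Fin 2) (Fin 2) (LocalRing L v))).det) w =
      (a w • gw + b w • (1 : Matrix (Fin 2) (Fin 2) (w.1.adicCompletion L))).det := fun a b => by
    have e1 : ((a • ((γH.1.val : GL (Fin 2) (LocalRing L v)).val : Matrix (Fin 2) (Fin 2) (LocalRing L v)) + b • (1 : Matrix (Fin 2) (Fin 2) (LocalRing L v))).det) w =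
        evw ((a • ((γH.1.val : GL (Fin 2) (LocalRing L v)).val : Matrix (Fin 2) (Fin 2) (LocalRing L v)) + b • (1 : Matrix (Fin 2) (Fin 2) (LocalRing L v))).det) := rfl
    rw [e1, RingHom.map_det, RingHom.mapMatrix_apply, map_smul_add_smul_one]
    rfl
  have hvm2 : Valued.v (((2 : w.1.adicCompletion L) • (1 : Matrix (Fin 2) (Fin 2) (w.1.adicCompletion L)) + (cw - 1) • X₂).det) = 1 := by
    have e := hdet2w (c - 1) (c + 1)
    rw [show (c - 1) w = cw - 1 from rfl, show (c + 1) w = cw + 1 from rfl, hgX, smul_one_add_smul_add_smul_one X₂ cw (cw - 1) (cw + 1) (by ring), Matrix.det_smul,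
      Fintype.card_fin] at e
    have h := hw2m
    rw [e, map_mul, map_pow, hc, ← WithZero.exp_nsmul] at h
    have hne : WithZero.exp ((2 : ℕ) • (-1 : ℤ)) ≠ 0 := WithZero.exp_ne_zero
    have h' := (eq_inv_mul_iff_mul_eq₀ hne).2 h
    rw [h', ← WithZero.exp_neg, ← WithZero.exp_add, ← WithZero.exp_zero, WithZero.exp_inj]
    simp
  have hNu : IsUnit (((2 : w.1.adicCompletion L) • (1 : Matrix (Fin 2) (Fin 2) (w.1.adicCompletion L)) + (cw - 1) • X₂).det) :=
    isUnit_iff_ne_zero.2 fun h0 => by rw [h0, map_zero] at hvm2; exact zero_ne_one hvm2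
  have hg'w : ((γH'.1.val : GL (Fin 2) (LocalRing L v)).val.map evw) =
      ((2 : w.1.adicCompletion L) • (1 : Matrix (Fin 2) (Fin 2) (w.1.adicCompletion L)) + (cw + 1) • X₂) * ((2 : w.1.adicCompletion L) • (1 : Matrix (Fin 2) (Fin 2) _) + (cw - 1) • X₂)⁻¹ := by
    rw [h1, map_moebius evw _ _ _ hU2m, map_add, map_sub, map_one]
    change ((cw + 1) • gw + (cw - 1) • (1 : Matrix (Fin 2) (Fin 2) (w.1.adicCompletion L))) * ((cw - 1) • gw + (cw + 1) • 1)⁻¹ = _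
    rw [hgX]; exact moebius_one_add_smul_eq X₂ hc0 hNu
  have hg'i : ∀ i j, Valued.v (((γH'.1.val : GL (Fin 2) (LocalRing L v)).val.map evw) i j) ≤ 1 := by
    rw [hg'w]; exact forall_valued_moebius_le_one hc1.le hX₂i hvm2
  -- `u′_w` is a unit
  have huw' : finGammaTwo L v γH' w = ((cw + 1) * uw + (cw - 1)) / ((cw - 1) * uw + (cw + 1)) := by
    have hmul : finGammaTwo L v γH' * ((c - 1) * finGammaTwo L v γH + (c + 1)) = (c + 1) * finGammaTwo L v γH + (c - 1) := by
      rw [hu', mul_assoc, Ring.inverse_mul_cancel _ hU1m, mul_one]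
    have hmw := congrFun hmul w
    simp only [Pi.mul_apply, Pi.add_apply, Pi.sub_apply, Pi.one_apply] at hmw
    have hne : (cw - 1) * uw + (cw + 1) ≠ 0 := fun h => by
      have e : ((c - 1) * finGammaTwo L v γH + (c + 1)) w = (cw - 1) * uw + (cw + 1) := rfl
      rw [e, h, map_zero] at hw1m; exact WithZero.zero_ne_coe hw1m
    rw [eq_div_iff hne]
    exact hmw
  have hw1m' : Valued.v ((cw - 1) * uw + (cw + 1)) = WithZero.exp (-1 : ℤ) := hw1m
  have hw1p' : Valued.v ((cw + 1) * uw + (cw - 1)) = WithZero.exp (-1 : ℤ) := hw1p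
  have hu'i : Valued.v (finGammaTwo L v γH' w) ≤ 1 := by rw [huw', valued_moebius_one_eq_one hw1m' hw1p']
  -- the block matrix `ι(γ_H′)_w` is entrywise integral
  have hι : (((endoEmbLocal L v γH').val : GL (Fin 3) (LocalRing L v)).val.map evw) =
      Matrix.reindex endoPerm endoPerm (Matrix.fromBlocks (((γH'.1.val : GL (Fin 2) (LocalRing L v)).val.map evw)) 0 0 (((γH'.2.val : GL (Fin 1) (LocalRing L v)).val.map evw))) := by
    rw [coe_endoEmbLocal, coe_endoGL, Matrix.reindex_apply, ← Matrix.submatrix_map, Matrix.fromBlocks_map]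
    simp [Matrix.reindex_apply]
  have hU'00 : (((γH'.2.val : GL (Fin 1) (LocalRing L v)).val.map evw)) 0 0 = finGammaTwo L v γH' w := rfl
  have hent : ∀ i j, ((((endoEmbLocal L v γH').val : GL (Fin 3) (LocalRing L v)).val.map evw) i j) ∈ O := by
    intro i j
    rw [hι, Matrix.reindex_apply, Matrix.submatrix_apply]
    refine hO.2 ?_
    rcases endoPerm.symm i with a | a <;> rcases endoPerm.symm j with b | b
    · rw [Matrix.fromBlocks_apply₁₁]; exact hg'i a b
    · rw [Matrix.fromBlocks_apply₁₂, Matrix.zero_apply, map_zero]; exact zero_le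
    · rw [Matrix.fromBlocks_apply₂₁, Matrix.zero_apply, map_zero]; exact zero_le
    · obtain rfl : a = 0 := Subsingleton.elim _ _
      obtain rfl : b = 0 := Subsingleton.elim _ _
      rw [Matrix.fromBlocks_apply₂₂, hU'00]; exact hu'i
  intro i
  exact charpoly_coeff_mem_of_forall_mem O hent i

end Literature.NumberTheory.Rogawski1990

end
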